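import Summits.QuantumFields.YangMills.Theorems.UnitScaleTiltHistoryTailLaneTailV4ChiDisplays
import Summits.QuantumFields.YangMills.Theorems.UnitScaleTiltMinimiserStabilityRegPrAttainmentOfExistence
import Summits.QuantumFields.YangMills.Theorems.UnitScaleTiltMinimiserStabilityRegPrStubHalvingStep
import Summits.QuantumFields.YangMills.Theses.UnitScaleTilt
import HarnessLib

/-!
# `Lines/unbundled_v6.lean` — PRE-FLIGHT TWIN (same two row BYTES as the of-record file; concluder INLINES w3 g20's §1+§2 through LANDED theorems so it compiles before
# `Theorems/UnitScaleTiltHistoryTailOfExistenceMinimalOrbitV4.lean` lands) — crux `HistoryTailL` (stmt-QuantumFields-19936), ideator ym-r3-idea-2 g17 under ★★OWNER WORDS 85 (2) ∕ 86 (2);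
# ns `…Cruxes.HistoryTailL.UnbundledV6`.  NOT the registered bytes.

WHAT IT DISPLAYS.  The K2 DAG of record (★★OWNER WORD 85, census `RECORD-UNBUNDLING-CENSUS-w3g20.md` d30d44609e4a111c = evidence #48; memo `Cruxes/HistoryTailL/RECORD-UNBUNDLING.md`):
`HistoryTailL` ⟸ χ-record `AlphaInputsT3ACv4RecChi` ⟸ `PinnedPartsT3ACRecSelXsV4Chi` (constants∕collar∕γ₀ rows ✓discharged ∀ L > 1, (71)_sym ✓discharged ∀ odd L > 1) ⟸ by the
L-R4 door ✓`historyTailL_of_thm1In8_selXsV4DataRows_allL (hT8) (hrows)` exactly TWO open content rows, with the (T8) row REPLACED by 19200's registered row EX (★★OWNER WORD 86 (2)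
preference; (T8) ⟸ EX alone by ✓`AttainmentOfExistence.thm1In8GlobalMin_of_halvingStep_of_existence` over the LANDED halving leaf ✓p705908 `MinimiserStabilityRegPrStubHalvingStep.stub_halvingStep`):
* `stub_existenceMinimalOrbit` — 19200 v10's row EX VERBATIM (`Cruxes/MinimiserStabilityRegPr/Lines/birth_v10.lean` :113–121; [Balaban1985Variational] Prop. 7's existence clause from a
  background (14), reading R1, every `B₃ > 4`) — ONE SHARED ITEM: a single landing credits 19200's only active row AND this row.  OPEN (19200 lines (α)∕(β), LOD∕EX-display).
* `stub_selXsV4DataRows` — the door's `hrows` binder VERBATIM (`Theorems/UnitScaleTiltHistoryTailLaneTailV4ChiDisplays.lean` :61–80): per odd `L > 1` a floor `B₀` and a box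
  `(0, A₀] × (0, A₁]` on which, for `(B, a₀, a₁)` in range with (T) at that box, thresholds `(b₁, p₁)`, per profile a constants record (exact profile, `B₃ = B`, three `C68` size rows) and per
  [7]-family the seam row (71)_sym `SmallFactor71OfRecT3` at every `(γ, K)` and (O‴χₛ) «if some pinned minimiser selection satisfies `TrivMinimiserRowsT3`, one does that ALSO carries
  NODE O d = 3's Sect. B–C χ-data `DataRowsT3XsChiSel`».  Its size∕seam parts are ✓discharged bookkeeping (`pinnedPartsT3ACRecSelXsV4Chi_shell`, `smallFactor71OfRecT3_of_gamma0_dL`); its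
  CONTENT is NODE O d = 3 (bill B0–B4; class-A rows `fibre55Win`∕`fibre57LowOn` for `avT3`).  OPEN, multi-seat.
RULING №39: exactly ONE theorem below concludes the crux decl BY NAME, zero extra hypotheses.  RULING №38: EX is guarded `1 < L` (19200's stamped letter); row 2 is guarded `Odd L → 1 < L`
and served under the antecedents `Thm1GlobalMinAt L a₀ a₁ B →` and `(∃ Ut, TrivMinimiserRowsT3 …) →`; neither row is refutable from tree facts known to the author (negatives index 08-29;
cell FINDING #44 concerns the NON-χ lower row only).  INDEPENDENCE: EX says nothing about expansion data; row 2 is vacuous without (T) — neither alone is the crux.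
HONEST: a registry DISPLAY; EX and (O‴χₛ) are displayed hypotheses, NOT proved; nothing of [Balaban1985Variational] Thm 1∕Prop. 7 or [Balaban1985UV3] Sect. B–C is proved; 19936
`HistoryTailL` is NOT proved — REDUCED to {EX, (O‴χₛ)}; R3 = SU(2) YM₃ on T³ — NOT d = 4, NOT infinite volume, NOT a mass gap, NOT Clay.
[cite: Balaban1985Variational, Thm 1 (8) p.279, Prop. 7 p.299, Prop. 8 p.304; Balaban1985UV3, (5) p.256, (47) p.267, (67)–(71) p.273 and Thm 2 p.272]
-/
set_option autoImplicit false

noncomputable section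

open MeasureTheory Set
open scoped Matrix.Norms.L2Operator
open Literature.MathematicalPhysics.QuantumFieldTheory.Balaban1983to89
open Literature.MathematicalPhysics.QuantumFieldTheory.Balaban1983to89.T3ContinuumYM3Torus
open Literature.MathematicalPhysics.QuantumFieldTheory.Balaban1983to89.T3UnitLawDensityEML (ℰp)
open Literature.MathematicalPhysics.QuantumFieldTheory.Balaban1983to89.T3PrintedRegularMinimiser
open Literature.MathematicalPhysics.QuantumFieldTheory.Balaban1983to89.T3PrintedMinimiserExistence
open Literature.MathematicalPhysics.QuantumFieldTheory.Balaban1983to89.T3ConstrainedMinimiser (fibre)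
open Literature.MathematicalPhysics.QuantumFieldTheory.Balaban1983to89.T3LowerAlongMinimisersSplit (MinimisersIn8At)
open Literature.MathematicalPhysics.QuantumFieldTheory.Balaban1983to89.ExpMeanLog (deltaSU)
open Literature.MathematicalPhysics.QuantumFieldTheory.Balaban1985CMP102
open Literature.MathematicalPhysics.QuantumFieldTheory.Balaban1985CMP102.Setting
open Summit.QuantumFields.Balaban3D.Carriers
open Summit.QuantumFields.Balaban3D.Proofs.Primitives
open Summit.QuantumFields.Balaban3D.Proofs.Thresholds (Q0)
open B7Prop2Explicit (C0)
open Summit.QuantumFields.YangMills.Theorems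

namespace Summit.QuantumFields.YangMills.Cruxes.HistoryTailL.UnbundledV6

/-! ## §1 The two registered rows (the ONLY sorries) -/

/-- ROW EX (SHARED with 19200 v10 `stub_existenceMinimalOrbit`, text VERBATIM) — [Balaban1985Variational] Prop. 7's existence clause from a background (14), reading R1: for every
`L > 1`, `B₃ > 4` some `a′₁ > 0`, `O₁ ≥ 1` such that for every member, `0 < ε₁ ≤ a′₁`, every (7)-datum `V` and every background `U₀ ∈ 𝔘_k(L³B₃ε₁) ∩ 𝔅_k(V)` there is a minimiser of the
Wilson action over print's regular fibre `(6)(O₁L³B₃ε₁)`. [cite: Balaban1985Variational, Prop. 7 p.299, (14) p.280, Thm 1 (8) p.279] -/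
theorem stub_existenceMinimalOrbit : ∀ (L : ℕ), 1 < L → ∀ (B₃ : ℝ), 4 < B₃ → ∃ a₁' O₁ : ℝ, 0 < a₁' ∧ 1 ≤ O₁ ∧
    ∀ (F : T3Family), F.L = L → ∀ (n K : ℕ) (hnK : n < K) (ε₁ : ℝ), 0 < ε₁ →
      ∀ V : GaugeField (F.P n) 0 (Matrix.specialUnitaryGroup (Fin 2) ℂ), PlaqSmall ε₁ V →
        ∀ U₀ : GaugeField (F.P K) 0 (Matrix.specialUnitaryGroup (Fin 2) ℂ), RegPr F n K ((L : ℝ) ^ 3 * B₃ * ε₁) U₀ → U₀ ∈ fibre F ℰp n K hnK.le V →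
          ε₁ ≤ a₁' → ∃ U ∈ regFibrePr F n K hnK.le (O₁ * (L : ℝ) ^ 3 * B₃ * ε₁) V,
            IsMinOn (fun W : GaugeField (F.P K) 0 (Matrix.specialUnitaryGroup (Fin 2) ℂ) => wilsonAction4 W)
              (regFibrePr F n K hnK.le (O₁ * (L : ℝ) ^ 3 * B₃ * ε₁) V) U := by
  sorry

/-- ROW (O‴χₛ)+record rows on the supplier's box — the `hrows` binder of ✓`historyTailL_of_thm1In8_selXsV4DataRows_allL` VERBATIM (NODE O d = 3's χ-data for one pinned minimiser
selection per record of the supplier's box, with the record's size rows and the seam row (71)_sym). [cite: Balaban1985UV3, (47) p.267, (67)–(71) p.273 and Thm 2 p.272] -/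
theorem stub_selXsV4DataRows : ∀ L : ℕ, Odd L → 1 < L → ∃ (B₀ A₀ A₁ : ℝ), 0 < A₀ ∧ 0 < A₁ ∧
  ∀ (B a₀ a₁ : ℝ), B₀ ≤ B → 1 ≤ 2 * B → 0 < a₀ → a₀ ≤ A₀ → 0 < a₁ → a₁ ≤ A₁ → B * a₁ ≤ a₀ →
    (143 * ((((3 + 4 : ℕ) : ℝ)) ^ 2 / 4) ^ 2) * (2 * (B * a₁)) ≤ 1 / 3 →
    2 * (2 * (B * a₁)) ≤ 2 * deltaSU (Fin 2) / (((3 + 4) * L : ℕ) : ℝ) ^ 2 →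
    Thm1GlobalMinAt L a₀ a₁ B →
    ∃ (b₁ p₁ : ℝ), ∀ (b₀ p₀ : ℝ), b₁ ≤ b₀ → p₁ ≤ p₀ →
      ∃ 𝔠 : AlphaConsts L (suGroupModel 2).N, 𝔠.b₀ = b₀ ∧ 𝔠.p₀ = p₀ ∧ 𝔠.B₃ = B ∧
        4 * 𝔠.B₃ * (L : ℝ) ^ 2 * avgWindowFactor L ≤ 𝔠.C68 ∧
        Real.exp (𝔠.p₀ - 1) ≤ 3 * C0 3 * 𝔠.C68 * (𝔠.b₀ * Q0 𝔠.p₀) ∧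
        (𝔠.b₀ * Q0 𝔠.p₀) * (2 * (L : ℝ) ^ 2 * avgWindowFactor L) ^ 2 ≤ 3 * C0 3 * 𝔠.C68 * a₁ ^ 2 ∧
        ∀ (F : T3Family) (hF : F.L = L),
          (∀ (γ : ℝ) (hγ : 0 < γ) (hγ1 : γ ≤ (min (hF ▸ 𝔠).gamma0 1) ^ 2) (K : ℕ),
            AlphaInputsT3AC.SmallFactor71OfRecT3 F (hF ▸ 𝔠) γ hγ hγ1 K) ∧
          ∀ (γ : ℝ) (hγ : 0 < γ) (hγ1 : γ ≤ (min (hF ▸ 𝔠).gamma0 1) ^ 2) (K : ℕ),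
            (∃ Ut : (k : ℕ) → GaugeField (F.P K) k (Matrix.specialUnitaryGroup (Fin 2) ℂ) →
                GaugeField (F.P K) 0 (Matrix.specialUnitaryGroup (Fin 2) ℂ),
              AlphaInputsT3AC.TrivMinimiserRowsT3 F (hF ▸ 𝔠) γ hγ hγ1 a₀ a₁ K Ut) →
            ∃ Ut : (k : ℕ) → GaugeField (F.P K) k (Matrix.specialUnitaryGroup (Fin 2) ℂ) →
                GaugeField (F.P K) 0 (Matrix.specialUnitaryGroup (Fin 2) ℂ),
              AlphaInputsT3AC.TrivMinimiserRowsT3 F (hF ▸ 𝔠) γ hγ hγ1 a₀ a₁ K Ut ∧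
                AlphaInputsT3AC.DataRowsT3XsChiSel F (hF ▸ 𝔠) γ hγ hγ1 K Ut := by
  sorry

/-! ## §2 The crux BY NAME — no sorry below this line -/

/-- **`HistoryTailL ⇐ stub_existenceMinimalOrbit ∧ stub_selXsV4DataRows`** — PRE twin of `HistoryTailL_of_stubs`: the L-R4 door with `hT8` discharged from EX over the landed halving leaf. -/
theorem HistoryTailL_of_stubs : Summit.QuantumFields.YangMills.Theses.UnitScaleTilt.HistoryTailL :=
  HistoryTailLaneTailV4Chi.historyTailL_of_thm1In8_selXsV4DataRows_allL
    (AttainmentOfExistence.thm1In8GlobalMin_of_halvingStep_of_existence MinimiserStabilityRegPrStubHalvingStep.stub_halvingStep stub_existenceMinimalOrbit)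
    stub_selXsV4DataRows

end Summit.QuantumFields.YangMills.Cruxes.HistoryTailL.UnbundledV6

end
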